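import Literature.AnabelianGeometry.AbsoluteAnabelian.ArchimedeanHolFieldFunctorGeometricPlaneComplTwist
import HarnessLib

/-!
# Biholomorphisms between finitely punctured planes, III: `Aut(ℂ ∖ S)` is finite for `|S| ≥ 2`

Classical: an automorphism of the sphere with `n + 1 ≥ 3` punctures is determined by the permutation
it induces on the punctures, so the automorphism group is finite (of order at most `(n+1)!`; generic
configurations have trivial group, `ℂ ∖ {0, 1}` has the anharmonic `𝔖₃`) — J. B. Conway, *Functions of
One Complex Variable I* (1978), Ch. V Thm. 1.21 with Ch. III §3 (a Möbius transformation is determined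
by three values).  Over `PuncturedPlaneEnds` / `PuncturedPlaneAutomorphisms` (every automorphism is
Möbius; one fixing every puncture is the identity) we prove, for `U = ℂ ∖ S` with `S` finite containing
two distinct points and `φ₁, φ₂ ∈ holAut U` ([AbsTopIII] Def. 2.1 (i)):

* `PuncturedPlane.eq_of_forall_tendsto` — if `φ₁` and `φ₂` move every puncture `p ∈ S` to the same
  end, then `φ₁ = φ₂`;
* `PuncturedPlane.finite_holAut` — **`Aut^hol(ℂ ∖ S)` is finite** (it injects into the finite set of
  maps `S → S ∪ {∞}`).

No definitions.  [cite: Conway1978, Ch. V Thm. 1.21 and Def. 1.3]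
-/

noncomputable section

namespace Literature.Analysis.Complex

namespace PuncturedPlane

open _root_.Filter _root_.Topology _root_.Metric _root_.Set _root_.Function
open scoped _root_.Manifold _root_.ContDiff
open _root_.TopologicalSpace (Opens)
open Literature.AnabelianGeometry.AbsoluteAnabelian

variable {S : Set ℂ} {U : Opens ℂ} (hU : (U : Set ℂ) = Sᶜ)

include hU in
/-- **An automorphism of `ℂ ∖ S` (`|S| ≥ 2`) is determined by where it sends the punctures**: if
`φ₁, φ₂ ∈ Aut^hol(ℂ ∖ S)` move every `p ∈ S` to the same end (both ambient representatives tend to a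
common end of `ℂ ∖ S` at each `p`), then `φ₁ = φ₂` (`φ₂⁻¹ ∘ φ₁` fixes every puncture).
[cite: Conway1978, Ch. V Thm. 1.21 and Def. 1.3] -/
theorem eq_of_forall_tendsto (hS : S.Finite) {p₁ p₂ : ℂ} (hp₁ : p₁ ∈ S) (hp₂ : p₂ ∈ S) (hp : p₁ ≠ p₂)
    {φ₁ φ₂ : U ≃ₜ U} (hφ₁ : φ₁ ∈ holAut U) (hφ₂ : φ₂ ∈ holAut U) {f₁ f₂ : ℂ → ℂ}
    (hf₁ : ∀ x : U, (φ₁ x : ℂ) = f₁ x) (hf₂ : ∀ x : U, (φ₂ x : ℂ) = f₂ x)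
    (h : ∀ p ∈ S, ∃ l : Filter ℂ, (l = cocompact ℂ ∨ ∃ q ∈ S, l = 𝓝[≠] q) ∧
      Tendsto f₁ (𝓝[≠] p) l ∧ Tendsto f₂ (𝓝[≠] p) l) : φ₁ = φ₂ := by
  classical
  -- ambient representatives of `φ₂⁻¹` and of `ψ := φ₂⁻¹ ∘ φ₁`
  let f₂' : ℂ → ℂ := fun z => if hz : z ∈ U then (φ₂.symm ⟨z, hz⟩ : ℂ) else 0
  have hf₂' : ∀ x : U, (φ₂.symm x : ℂ) = f₂' x := fun x => by simp only [f₂', dif_pos x.2]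
  set ψ : U ≃ₜ U := φ₂⁻¹ * φ₁ with hψdef
  have hψ : ψ ∈ holAut U := (holAut U).mul_mem ((holAut U).inv_mem hφ₂) hφ₁
  have hψf : ∀ x : U, (ψ x : ℂ) = (f₂' ∘ f₁) x := fun x => by
    rw [hψdef, Homeomorph.mul_apply, Function.comp_apply, ← hf₁]
    exact hf₂' (φ₁ x)
  have hφ₂d : MDifferentiable 𝓘(ℂ, ℂ) 𝓘(ℂ, ℂ) φ₂ := ((mem_holAut_iff φ₂).mp hφ₂).1
  -- `ψ` fixes every puncture
  have hfix : ∀ p ∈ S, Tendsto (f₂' ∘ f₁) (𝓝[≠] p) (𝓝 p) := by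
    intro p hpS
    obtain ⟨l, hl, h₁, h₂⟩ := h p hpS
    have h₂' : Tendsto f₂' l (𝓝[≠] p) :=
      tendsto_symm_of_tendsto hU hS hφ₂d hf₂ hf₂' (Or.inr ⟨p, hpS, rfl⟩) hl h₂
    exact (h₂'.comp h₁).mono_right nhdsWithin_le_nhds
  have hψid := eq_id_of_mem_holAut_of_forall_tendsto hU hS hp₁ hp₂ hp hψ hψf hfix
  -- `φ₂⁻¹ * φ₁ = 1` ⇒ `φ₁ = φ₂`
  have : φ₂⁻¹ * φ₁ = 1 := hψid
  exact (inv_mul_eq_one.mp this).symm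

include hU in
/-- **`Aut^hol(ℂ ∖ S)` is finite** for `S ⊆ ℂ` finite with two distinct points: by
`eq_of_forall_tendsto` the assignment «puncture ↦ its image end» (a map `S → S ∪ {∞}`, here
`↥S → Option ↥S`) is injective on `holAut U`, and there are finitely many such maps.
[cite: Conway1978, Ch. V Thm. 1.21 and Def. 1.3] -/
theorem finite_holAut (hS : S.Finite) {p₁ p₂ : ℂ} (hp₁ : p₁ ∈ S) (hp₂ : p₂ ∈ S) (hp : p₁ ≠ p₂) :
    (holAut U : Set (U ≃ₜ U)).Finite := by
  classical
  haveI : Finite ↥S := hS.to_subtype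
  -- ambient representative of an automorphism
  let rep : (U ≃ₜ U) → ℂ → ℂ := fun φ z => if hz : z ∈ U then (φ ⟨z, hz⟩ : ℂ) else 0
  have hrep : ∀ φ : U ≃ₜ U, ∀ x : U, (φ x : ℂ) = rep φ x := fun φ x => by
    simp only [rep, dif_pos x.2]
  -- the end a puncture is moved to: `some q` (finite puncture `q`) or `none` (`∞`)
  let endOf : (U ≃ₜ U) → ↥S → Option ↥S := fun φ p =>
    if hq : ∃ q : ↥S, Tendsto (rep φ) (𝓝[≠] (p : ℂ)) (𝓝[≠] (q : ℂ)) then some hq.choose else none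
  -- on `holAut U`, `endOf φ p` records the end `f` tends to at `p`
  have hend : ∀ φ ∈ holAut U, ∀ p : ↥S, ∃ l : Filter ℂ, (l = cocompact ℂ ∨ ∃ q ∈ S, l = 𝓝[≠] q) ∧
      Tendsto (rep φ) (𝓝[≠] (p : ℂ)) l ∧
      (endOf φ p = none ↔ l = cocompact ℂ) ∧ (∀ q : ↥S, endOf φ p = some q ↔ l = 𝓝[≠] (q : ℂ)) := by
    intro φ hφ p
    have hφd : MDifferentiable 𝓘(ℂ, ℂ) 𝓘(ℂ, ℂ) φ := ((mem_holAut_iff φ).mp hφ).1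
    haveI : (𝓝[≠] (p : ℂ)).NeBot := NormedField.nhdsNE_neBot _
    obtain ⟨l, hl, hlT⟩ := end_trichotomy hU hU hS hφd (hrep φ) (Or.inr ⟨p, p.2, rfl⟩)
    refine ⟨l, hl, hlT, ?_, ?_⟩
    · constructor
      · intro hnone
        rcases hl with h | ⟨q, hq, rfl⟩
        · exact h
        · exfalso
          have hex : ∃ q' : ↥S, Tendsto (rep φ) (𝓝[≠] (p : ℂ)) (𝓝[≠] (q' : ℂ)) := ⟨⟨q, hq⟩, hlT⟩
          have : endOf φ p = some hex.choose := by simp only [endOf, dif_pos hex]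
          rw [hnone] at this
          exact Option.some_ne_none _ this.symm
      · intro hlc
        by_contra hne
        obtain ⟨q', hq'⟩ := Option.ne_none_iff_exists'.mp hne
        have hex : ∃ q' : ↥S, Tendsto (rep φ) (𝓝[≠] (p : ℂ)) (𝓝[≠] (q' : ℂ)) := by
          by_contra hno
          have : endOf φ p = none := by simp only [endOf, dif_neg hno]
          exact hne this
        have h2 := hex.choose_spec
        have := end_unique (T := S) (Or.inr ⟨_, hex.choose.2, rfl⟩) hl h2 hlT
        rw [hlc] at this
        exact nhdsNE_ne_cocompact _ this
    · intro q
      constructor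
      · intro hsome
        have hex : ∃ q' : ↥S, Tendsto (rep φ) (𝓝[≠] (p : ℂ)) (𝓝[≠] (q' : ℂ)) := by
          by_contra hno
          have : endOf φ p = none := by simp only [endOf, dif_neg hno]
          rw [hsome] at this
          exact Option.some_ne_none _ this
        have hch : endOf φ p = some hex.choose := by simp only [endOf, dif_pos hex]
        rw [hsome] at hch
        have hqq : q = hex.choose := Option.some_injective _ hch
        have h2 := hex.choose_spec
        rw [← hqq] at h2
        exact (end_unique (T := S) hl (Or.inr ⟨_, q.2, rfl⟩) hlT h2)
      · intro hlq
        have hex : ∃ q' : ↥S, Tendsto (rep φ) (𝓝[≠] (p : ℂ)) (𝓝[≠] (q' : ℂ)) := ⟨q, hlq ▸ hlT⟩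
        have hch : endOf φ p = some hex.choose := by simp only [endOf, dif_pos hex]
        rw [hch]
        congr 1
        apply Subtype.ext
        have h2 := hex.choose_spec
        have := end_unique (T := S) (Or.inr ⟨_, hex.choose.2, rfl⟩) (Or.inr ⟨_, q.2, rfl⟩) h2
          (hlq ▸ hlT)
        exact eq_of_nhdsNE_eq this
  -- injectivity of `endOf` on `holAut U`
  have hinj : Set.InjOn endOf (holAut U : Set (U ≃ₜ U)) := by
    intro φ₁ hφ₁ φ₂ hφ₂ heq
    refine eq_of_forall_tendsto hU hS hp₁ hp₂ hp hφ₁ hφ₂ (hrep φ₁) (hrep φ₂) fun p hpS => ?_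
    obtain ⟨l₁, hl₁, h₁, hn₁, hs₁⟩ := hend φ₁ hφ₁ ⟨p, hpS⟩
    obtain ⟨l₂, hl₂, h₂, hn₂, hs₂⟩ := hend φ₂ hφ₂ ⟨p, hpS⟩
    have heqp : endOf φ₁ ⟨p, hpS⟩ = endOf φ₂ ⟨p, hpS⟩ := congrFun heq ⟨p, hpS⟩
    refine ⟨l₁, hl₁, h₁, ?_⟩
    rcases hl₁ with h | ⟨q, hq, h⟩
    · have e1 : endOf φ₁ ⟨p, hpS⟩ = none := hn₁.mpr h
      rw [e1] at heqp
      rw [h, ← hn₂.mp heqp.symm]; exact h₂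
    · have e1 : endOf φ₁ ⟨p, hpS⟩ = some ⟨q, hq⟩ := (hs₁ ⟨q, hq⟩).mpr h
      rw [e1] at heqp
      rw [h, ← (hs₂ ⟨q, hq⟩).mp heqp.symm]; exact h₂
  exact Set.Finite.of_finite_image (Set.toFinite (endOf '' (holAut U : Set (U ≃ₜ U)))) hinj
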